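import Literature.Geometry.Lorentzian.SpacetimeLocalConvergence
import Literature.Geometry.Lorentzian.MultiCentreKerrSchild
import Literature.Geometry.Lorentzian.ChartCalculus
import HarnessLib

/-!
# Near-Minkowski chart spacetimes: the limit objects of local Cheeger–Gromov compactness

A field `G : E4 → (E4 →L E4 →L ℝ)` of symmetric bilinear forms on an open set `O ⊆ E4`, smooth on
`O` and `C⁰`-close to the Minkowski form (`‖G(y) − η‖ < 1` on `O`), is a smooth LORENTZIAN metric
on the open submanifold `O` (perturbative signature lemmas `Minkowski.nondegenerate_of_spatial_pos`,
`Minkowski.pos_of_orthogonal_of_spatial_pos`: O'Neill 1983, Ch. 5, Lemma 5.26), time-oriented by the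
constant field `∂₀` (`G(∂₀, ∂₀) ≤ −1 + ‖G − η‖ < 0`). For connected `O` this is a bundled
`Spacetime 4` with carrier `↥O` — `NearMinkowskiChart.spacetime` — whose metric components in its
own (inclusion) chart are `G` itself (`metricInCoords_chartAt_symm`). These are exactly the limit
objects produced by the local (one-chart) Cheeger–Gromov compactness theorem for uniformly tame
pointed spacetimes (`TameChartCompactness.lean`): the `Cᵏ_loc` limit of the metric components of a
sequence of tame charts is such a field, and the chart domain with the limit components is the limit
spacetime (Petersen 2006, Ch. 10, §3.2, "the limit metric in the limit charts").

## References
* B. O'Neill, *Semi-Riemannian geometry*, Academic Press 1983, Ch. 5, Lemma 5.26. [ONeill1983]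
* P. Petersen, *Riemannian Geometry*, 2nd ed., GTM 171, Springer 2006, Ch. 10, §3.2. [Petersen2006]
-/

noncomputable section

open Set Filter TopologicalSpace Bundle Function
open scoped Manifold ContDiff Topology

namespace Literature.Geometry.Lorentzian

/-! ### Near-Minkowski fields of bilinear forms on an open set -/

/-- **A near-Minkowski chart metric** on the open set `O ⊆ E4`: a field of bilinear forms
`G : E4 → (E4 →L E4 →L ℝ)` (total; only its values on `O` matter), smooth and symmetric on `O`,
with `‖G(y) − η‖ < 1` for `y ∈ O` — hence of Lorentzian signature there, with `∂₀` timelike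
(O'Neill 1983, Ch. 5, Lemma 5.26, perturbative form). The limit object of local Cheeger–Gromov
compactness. [cite: ONeill1983, Ch. 5, Lemma 5.26] -/
structure NearMinkowskiChart (O : Opens E4) where
  /-- The metric components. -/
  G : E4 → E4 →L[ℝ] E4 →L[ℝ] ℝ
  /-- The components are smooth on `O`. -/
  contDiffOn : ContDiffOn ℝ ∞ G O
  /-- The components are symmetric on `O`. -/
  symm : ∀ y ∈ (O : Set E4), ∀ v w : E4, G y v w = G y w v
  /-- The components are `C⁰`-close to the Minkowski form on `O`. -/
  norm_sub_lt : ∀ y ∈ (O : Set E4), ‖G y - Minkowski.bilin‖ < 1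

namespace NearMinkowskiChart

variable {O : Opens E4} (L : NearMinkowskiChart O)

/-- The components are smooth at every point of `O`. [folklore] -/
theorem contDiffAt (y : O) {n : ℕ∞} : ContDiffAt ℝ n L.G y :=
  ((L.contDiffOn.of_le (by exact_mod_cast le_top)).contDiffAt (O.2.mem_nhds y.2))

/-- `∂₀` is timelike for a near-Minkowski field: `G(y)(∂₀, ∂₀) < 0`. [cite: ONeill1983, Ch. 5, Lemma 5.26] -/
theorem apply_basisVector_zero_neg (y : O) : L.G y (E4.basisVector 0) (E4.basisVector 0) < 0 :=
  Minkowski.apply_basisVector_zero_neg_of_norm_sub_bilin_lt_one (L.norm_sub_lt y.1 y.2)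

/-- Spatial vectors are spacelike for a near-Minkowski field. [cite: ONeill1983, Ch. 5, Lemma 5.26] -/
theorem apply_self_pos (y : O) {u : E4} (hu0 : u 0 = 0) (hu : u ≠ 0) : 0 < L.G y u u :=
  Minkowski.apply_self_pos_of_norm_sub_bilin_lt_one (L.norm_sub_lt y.1 y.2) hu0 hu

/-- **The Lorentzian metric of a near-Minkowski field** on the open submanifold `O`
(signature by the perturbative lemmas, smoothness by the `OpensChart` section calculus).
[cite: ONeill1983, Ch. 5, Lemma 5.26] -/
def metric : LorentzianMetric 𝓘(ℝ, E4) ∞ O where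
  val y := L.G y.1
  symm y v w := L.symm y.1 y.2 v w
  nondegenerate y v hv :=
    Minkowski.nondegenerate_of_spatial_pos (L.symm y.1 y.2) (fun _ hu0 hu ↦ L.apply_self_pos y hu0 hu)
      (L.apply_basisVector_zero_neg y) v hv
  contMDiff y :=
    (OpensChart.contMDiffAt_bilinSection_iff y _ L.G (fun _ ↦ rfl)).2 (L.contDiffAt y)
  exists_timelike y := ⟨E4.basisVector 0, L.apply_basisVector_zero_neg y⟩
  pos_of_orthogonal y v w hv hvw hw :=
    Minkowski.pos_of_orthogonal_of_spatial_pos (L.symm y.1 y.2)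
      (fun _ hu0 hu ↦ L.apply_self_pos y hu0 hu) v w hv hvw hw

/-- The metric at `y` is `G y`. [folklore] -/
@[simp]
theorem metric_val (y : O) : L.metric.val y = L.G y.1 := rfl

/-- **Time orientation by `∂₀`** (constant, hence smooth; timelike by
`apply_basisVector_zero_neg`). [cite: ONeill1983, Ch. 5, p. 145] -/
def timeOrientation : TimeOrientation L.metric where
  vectorField _ := (E4.basisVector 0 : E4)
  isTimelike y := L.apply_basisVector_zero_neg y
  contMDiff x := by
    rw [OpensChart.contMDiffAt_section_iff]
    exact contMDiffAt_const

/-- The orienting field is `∂₀`. [folklore] -/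
@[simp]
theorem timeOrientation_vectorField (y : O) :
    L.timeOrientation.vectorField y = (E4.basisVector 0 : E4) := rfl

/-- **The near-Minkowski chart spacetime** `(O, G, ∂₀)` for connected `O`: a bundled
`Spacetime 4` with carrier `↥O`. [cite: Petersen2006, Ch. 10 §3.2] -/
def spacetime (hO : IsConnected (O : Set E4)) : Spacetime 4 :=
  letI : ConnectedSpace O := isConnected_iff_connectedSpace.mp hO
  { carrier := O
    metric := L.metric
    timeOrientation := L.timeOrientation }

variable (hO : IsConnected (O : Set E4))

/-- The carrier of the near-Minkowski chart spacetime is `↥O`. [folklore] -/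
theorem spacetime_carrier : (L.spacetime hO).carrier = O := rfl

/-- Its metric at `y` is `G y`. [folklore] -/
@[simp]
theorem spacetime_metric_val (y : O) : (L.spacetime hO).metric.val y = L.G y.1 := rfl

/-- Its orienting field is `∂₀`. [folklore] -/
@[simp]
theorem spacetime_vectorField (y : O) :
    (L.spacetime hO).timeOrientation.vectorField y = (E4.basisVector 0 : E4) := rfl

/-- **The metric components of the near-Minkowski chart spacetime in its own chart are `G`**:
for every `x : O` and `y ∈ O`, `metricInCoords ((chartAt E4 x).symm) y = G y` (the chart is the
inclusion, its inverse has identity differential). [cite: Petersen2006, Ch. 10 §3.2] -/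
theorem metricInCoords_chartAt_symm (x : O) {y : E4} (hy : y ∈ (O : Set E4)) :
    (L.spacetime hO).metricInCoords (chartAt E4 x).symm y = L.G y := by
  set ψ : E4 → (L.spacetime hO).carrier := fun z ↦ (chartAt E4 x).symm z with hψ
  -- the differential of the inverse chart is the identity (the charted structure of the carrier
  -- of the bundled spacetime is that of `↥O`, definitionally)
  have hd : ∀ u : E4, mfderiv 𝓘(ℝ, E4) (𝓡 4) ψ y u = u := fun u ↦ by
    have h := OpensChart.mfderiv_extChartAt_symm_apply x hy u
    rw [OpensChart.extChartAt_eq] at h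
    exact h
  have hval : (ψ y).1 = y := OpensChart.chartAt_symm_val x hy
  ext v w
  rw [Spacetime.metricInCoords_apply, hd v, hd w]
  change L.G (ψ y).1 v w = L.G y v w
  rw [hval]

end NearMinkowskiChart

end Literature.Geometry.Lorentzian

end
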